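import Summits.AtomisticToContinuum.Crystallization.Theorems.FrustratedLawDichotomyStrainedPatchHomSlabConfine
import Summits.AtomisticToContinuum.Crystallization.Theorems.FrustratedLawDichotomyStrainedPatchHomExemptZeroStep

/-!
# The Q-FORM ring corollary: slab confinement `T″` with a direction-dependent curvature floor, and the componentwise confinement
# (27623 `(H) HomFloor (1/625)`, hcp half; critic row 1110 (1): «the 10-line Q-form variant `hcpForceLJ_slab_confinement_qform`»)

decomp-a2c hand-1 g29 (crux `AperiodicFrustratedLawGap`, stmt-AtomisticToContinuum-27623).  `…HomForceRing.hcpForceLJ_slab_confinement` takes a scalar floor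
`λ`; the matrix-shifted certificate `…HomCurvLJAnisoM.curvLJ_floorM_of_check` delivers a QUADRATIC FORM `Q(Δ) ≤ Σ segGd` (`Δ = U(ξ − ξ₀)`).  Feeding the ring
lemma with `λ := Q(Δ)/‖Δ‖²`:

* ★★ `hcpForceLJ_slab_confinement_qform` — `Q ≤ Σ_B segGd` along the segment (any real `Q`), reference bound `f₀`, target cap `σ` ⟹ `Q ≤ (σ + f₀)·‖U(ξ − ξ₀)‖`;
* ★★ `hcpForceLJ_coord_confinement` — with the PSD certificate `t‖x‖² + tγ²x_k² ≤ 2γr·Q(x)` (`t = σ + f₀ > 0`, `…HomSlabConfine.abs_apply_le_of_qcert`):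
  `|(U(ξ − ξ₀))_k| ≤ r` — the componentwise confinement (`|Δ_c| ≤ 1.16·10⁻³`, `|Δ_basal| ≤ 3.6·10⁻³` at the corner cell) of the CLAM memo as a theorem.

NO definitions; 0 sorry; standard axioms; no instances / notation / `#eval`.  `--supports stmt-AtomisticToContinuum-27623`.
-/

noncomputable section

namespace Summit.AtomisticToContinuum.Crystallization.Theorems.FrustratedLawDichotomyStrainedPatchHomForceRing

open scoped BigOperators RealInnerProductSpace
open Summit.AtomisticToContinuum.Crystallization.Theorems.ChargedEnergyGapNegative (E3)
open Summit.AtomisticToContinuum.Crystallization.Theorems.FrustratedLawDichotomyStrainedPatchHomSplit (latPt hexFrame hcpShift)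
open Summit.AtomisticToContinuum.Crystallization.Theorems.FrustratedLawDichotomyStrainedPatchTaylorChord (segGd)
open Summit.AtomisticToContinuum.Crystallization.Theorems.FrustratedLawDichotomyStrainedPatchHomSlabConfine (abs_apply_le_of_qcert)
open Summit.AtomisticToContinuum.Crystallization.Theorems.FrustratedLawDichotomyStrainedPatchHomExemptZeroStep (segGd_of_zero)

/-- ★★ **SLAB CONFINEMENT `T″`, Q-FORM**: `Q ≤ Σ_B segGd` along the segment from `ξ₀` to `ξ` (any real `Q`, e.g. the certified quadratic form at
`Δ = U(ξ − ξ₀)`), the reference force bound `f₀` and the target cap `σ` give `Q ≤ (σ + f₀)·‖U(ξ − ξ₀)‖`. [folklore chaining: `hcpForceLJ_slab_confinement`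
with `λ := Q/‖Δ‖²`] -/
theorem hcpForceLJ_slab_confinement_qform (B : Finset (Fin 3 → ℤ)) {U : E3 →L[ℝ] E3} (hU : ‖U - 1‖ ≤ 1 / 4) {ξ₀ ξ : E3} (hξ₀ : ‖ξ₀‖ ≤ 1 / 4)
    (hξ : ‖ξ‖ ≤ 1 / 4) {Q f₀ σ : ℝ}
    (hcurv : ∀ s ∈ Set.Ioo (0 : ℝ) 1, Q ≤
      ∑ bb ∈ B, segGd (fun x : ℝ => x⁻¹ ^ 7 - x⁻¹ ^ 13) (latPt U hexFrame bb + U (hcpShift + ξ₀)) (U (ξ - ξ₀)) s)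
    (hf₀ : |∑ bb ∈ B, (‖latPt U hexFrame bb + U (hcpShift + ξ₀)‖⁻¹ ^ 8 - ‖latPt U hexFrame bb + U (hcpShift + ξ₀)‖⁻¹ ^ 14) *
        ⟪latPt U hexFrame bb + U (hcpShift + ξ₀), U (ξ - ξ₀)⟫| ≤ f₀ * ‖U (ξ - ξ₀)‖)
    (hσ : ∑ bb ∈ B, (‖latPt U hexFrame bb + U (hcpShift + ξ)‖⁻¹ ^ 8 - ‖latPt U hexFrame bb + U (hcpShift + ξ)‖⁻¹ ^ 14) *
        ⟪latPt U hexFrame bb + U (hcpShift + ξ), U (ξ - ξ₀)⟫ ≤ σ * ‖U (ξ - ξ₀)‖) :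
    Q ≤ (σ + f₀) * ‖U (ξ - ξ₀)‖ := by
  by_cases hΔ : U (ξ - ξ₀) = 0
  · have h := hcurv (1 / 2) ⟨by norm_num, by norm_num⟩
    rw [hΔ] at h
    simp only [segGd_of_zero, Finset.sum_const_zero] at h
    rw [hΔ, norm_zero, mul_zero]
    exact h
  have hpos : 0 < ‖U (ξ - ξ₀)‖ := norm_pos_iff.2 hΔ
  have hcurv' : ∀ s ∈ Set.Ioo (0 : ℝ) 1, Q / ‖U (ξ - ξ₀)‖ ^ 2 * ‖U (ξ - ξ₀)‖ ^ 2 ≤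
      ∑ bb ∈ B, segGd (fun x : ℝ => x⁻¹ ^ 7 - x⁻¹ ^ 13) (latPt U hexFrame bb + U (hcpShift + ξ₀)) (U (ξ - ξ₀)) s := by
    intro s hs
    rw [div_mul_cancel₀ Q (pow_ne_zero 2 hpos.ne')]
    exact hcurv s hs
  have h := (hcpForceLJ_slab_confinement B hU hξ₀ hξ hΔ hcurv' hf₀ hσ).1
  have e : Q / ‖U (ξ - ξ₀)‖ ^ 2 * ‖U (ξ - ξ₀)‖ = Q / ‖U (ξ - ξ₀)‖ := by field_simp
  rw [e, div_le_iff₀ hpos] at h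
  exact h

/-- ★★ **COMPONENTWISE CONFINEMENT**: under the hypotheses of `hcpForceLJ_slab_confinement_qform` with `Q = Qf(U(ξ − ξ₀))` for a form `Qf`, a certificate
`t‖x‖² + tγ²x_k² ≤ 2γr·Qf(x)` for all `x` with `t = σ + f₀ > 0`, `γ > 0`, `r ≥ 0` gives `|(U(ξ − ξ₀))_k| ≤ r`. [folklore chaining: `…HomSlabConfine.abs_apply_le_of_qcert`] -/
theorem hcpForceLJ_coord_confinement (B : Finset (Fin 3 → ℤ)) {U : E3 →L[ℝ] E3} (hU : ‖U - 1‖ ≤ 1 / 4) {ξ₀ ξ : E3} (hξ₀ : ‖ξ₀‖ ≤ 1 / 4)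
    (hξ : ‖ξ‖ ≤ 1 / 4) (Qf : E3 → ℝ) {f₀ σ γ r : ℝ} (ht : 0 < σ + f₀) (hγ : 0 < γ) (hr : 0 ≤ r) (k : Fin 3)
    (hcert : ∀ x : E3, (σ + f₀) * ‖x‖ ^ 2 + (σ + f₀) * γ ^ 2 * (x k) ^ 2 ≤ 2 * γ * r * Qf x)
    (hcurv : ∀ s ∈ Set.Ioo (0 : ℝ) 1, Qf (U (ξ - ξ₀)) ≤
      ∑ bb ∈ B, segGd (fun x : ℝ => x⁻¹ ^ 7 - x⁻¹ ^ 13) (latPt U hexFrame bb + U (hcpShift + ξ₀)) (U (ξ - ξ₀)) s)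
    (hf₀ : |∑ bb ∈ B, (‖latPt U hexFrame bb + U (hcpShift + ξ₀)‖⁻¹ ^ 8 - ‖latPt U hexFrame bb + U (hcpShift + ξ₀)‖⁻¹ ^ 14) *
        ⟪latPt U hexFrame bb + U (hcpShift + ξ₀), U (ξ - ξ₀)⟫| ≤ f₀ * ‖U (ξ - ξ₀)‖)
    (hσ : ∑ bb ∈ B, (‖latPt U hexFrame bb + U (hcpShift + ξ)‖⁻¹ ^ 8 - ‖latPt U hexFrame bb + U (hcpShift + ξ)‖⁻¹ ^ 14) *
        ⟪latPt U hexFrame bb + U (hcpShift + ξ), U (ξ - ξ₀)⟫ ≤ σ * ‖U (ξ - ξ₀)‖) :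
    |(U (ξ - ξ₀)) k| ≤ r :=
  abs_apply_le_of_qcert (Q := Qf) ht hγ hr k hcert (hcpForceLJ_slab_confinement_qform B hU hξ₀ hξ hcurv hf₀ hσ)

end Summit.AtomisticToContinuum.Crystallization.Theorems.FrustratedLawDichotomyStrainedPatchHomForceRing

end
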